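import Mathlib
import Summits.KontsevichZagierPeriods.KontsevichZagierPeriods.Theorems.SoloInformedLegendreExact
import HarnessLib
import HarnessLib.Audit

/-!
# Legendre's relation by moves, V: the deformation in the modulus (solo-informed, s33)

For `μ ∈ (0,1)` real algebraic we run the Newton–Leibniz move (rule 3) of the Kontsevich–Zagier
calculus along the modulus `m ∈ [0, μ]` over the open square `(0,1)²`, with potential
`F(s,t,m) = (1 − m s² − (1−m) t²)·k`, `k = [(1−s²)(1−ms²)(1−t²)(1−(1−m)t²)]^{-1/2}`:

  `[(0,1)² × [0,μ], ∂_m F] ∼ [(0,1)², F(·,·,μ) − F(·,·,0)]`.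

The left side is a relation (files III–IV: `∂_m F = ∂_s A + ∂_t B` and both kills), and
`F(s,t,0) = (1 − s²)^{-1/2}` (file I), whence the **deformation theorem**

  `[(0,1)², (1 − μs² − μ't²)·k(s,t,μ)] ∼ [(0,1)², (1 − s²)^{-1/2}]`   (`μ' = 1 − μ`).

The left integrand is `e_μ(s)k_{μ'}(t) + k_μ(s)e_{μ'}(t) − k_μ(s)k_{μ'}(t)` (Legendre's combination),
the right side is `π/2 · 1`; file VII rewrites both sides as products of one-dimensional periods.

References: A.-M. Legendre, *Traité des fonctions elliptiques* I (1825) (as cited by McKean–Moll);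
E. T. Whittaker, G. N. Watson, *A Course of Modern Analysis* (4th ed.), §§ 22.735–22.736 and
Examples 22.7.15, 22.7.17 (`EK' + E'K − KK'` is constant in `c = k²`; Legendre's relation by `k → 0`);
H. McKean, V. Moll, *Elliptic Curves* (1997), § 2.4; M. Kontsevich, D. Zagier, *Periods* (2001), § 1.2;
this work (solo-informed s33).
-/

noncomputable section

open MeasureTheory Set Filter
open scoped Classical

open Literature.NumberTheory.Transcendental Literature.NumberTheory.Transcendental.KZ
open Literature.ModelTheory.ExponentialFields

namespace Summit.KontsevichZagierPeriods.KontsevichZagierPeriods.Theorems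

/-- `(1 − s²)^{-1/2}` is absolutely integrable on the open square. [folklore] -/
theorem soloInformed_integrableOn_inv_sqrt_box2 :
    IntegrableOn (fun z : Fin 2 → ℝ => (√(1 - z 0 ^ 2))⁻¹)
      {z : Fin 2 → ℝ | z 0 ∈ Ioo (0:ℝ) 1 ∧ z 1 ∈ Ioo (0:ℝ) 1} := by
  have hbox : IsSemialgebraic ℚ {z : Fin 2 → ℝ | z 0 ∈ Ioo (0:ℝ) 1 ∧ z 1 ∈ Ioo (0:ℝ) 1} := by
    rw [← soloInformed_box_two_eq]; exact isSemialgebraic_box 2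
  have hsa : IsSemialgebraicFunOn ℚ {z : Fin 2 → ℝ | z 0 ∈ Ioo (0:ℝ) 1 ∧ z 1 ∈ Ioo (0:ℝ) 1}
      (fun z : Fin 2 → ℝ => (√(1 - z 0 ^ 2))⁻¹) := by
    refine (soloInformed_sa_inv_sqrt_aeval hbox (1 - MvPolynomial.X 0 ^ 2) fun z hz => ?_).congr
      fun z _ => ?_
    · simp only [map_sub, map_one, map_pow, MvPolynomial.aeval_X]
      have h : z 0 ∈ Ioo (0:ℝ) 1 := hz.1
      nlinarith [h.1, h.2]
    · simp only [map_sub, map_one, map_pow, MvPolynomial.aeval_X]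
  refine soloInformed_integrableOn_of_le_inv_sqrt_prod hbox hsa ∅ {0} ∅ {0} 1 ∅ measure_empty
    (fun z hz _ j => ?_) (fun z _ hc => ?_)
  · have h : z 0 ∈ Ioo (0:ℝ) 1 ∧ z 1 ∈ Ioo (0:ℝ) 1 := hz
    fin_cases j
    · exact h.1
    · exact h.2
  · have h0 := soloInformed_inv_sqrt_one_sub_sq_le (hc 0)
    have hK0 : 0 ≤ (√(1 - z 0 ^ 2))⁻¹ := by positivity
    rw [abs_of_nonneg hK0, Finset.prod_empty, Finset.prod_singleton]
    linarith

/-- **THEOREM XVII, deformation half.**  For `μ ∈ (0,1)` real algebraic there are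
representations `Rμ = [(0,1)², (1 − μs² − (1−μ)t²)·k(s,t,μ)]` and `R₀ = [(0,1)², (1 − s²)^{-1/2}]`
with `Rμ ∼ R₀` in the Kontsevich–Zagier calculus: Newton–Leibniz in the modulus over the square
(rule 3) gives `[(0,1)² × [0,μ], ∂_m F] ∼ [(0,1)², F(·,μ) − F(·,0)]`, the left side is a relation
(file III), `F(·,0) = (1 − s²)^{-1/2}` (file I), and integrand additivity (rule 1b) finishes.
[this work] -/
theorem soloInformed_legendre_deformation (μ : ℝ) (hμ : μ ∈ Ioo (0:ℝ) 1)
    (hμa : IsAlgebraic ℚ μ) :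
    ∃ Rμ R₀ : IntegralRep 2,
      Rμ.domain = {z : Fin 2 → ℝ | z 0 ∈ Ioo (0:ℝ) 1 ∧ z 1 ∈ Ioo (0:ℝ) 1} ∧
      (∀ z, Rμ.integrand z = (1 - μ * z 0 ^ 2 - (1 - μ) * z 1 ^ 2) *
        ((√(1 - z 0 ^ 2))⁻¹ * (√(1 - μ * z 0 ^ 2))⁻¹ *
          ((√(1 - z 1 ^ 2))⁻¹ * (√(1 - (1 - μ) * z 1 ^ 2))⁻¹))) ∧
      R₀.domain = {z : Fin 2 → ℝ | z 0 ∈ Ioo (0:ℝ) 1 ∧ z 1 ∈ Ioo (0:ℝ) 1} ∧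
      (∀ z, R₀.integrand z = (√(1 - z 0 ^ 2))⁻¹) ∧
      of Rμ - of R₀ ∈ relations := by
  have snoc0 : ∀ (x : Fin 2 → ℝ) (c : ℝ), (Fin.snoc x c : Fin 3 → ℝ) 0 = x 0 := fun _ _ => rfl
  have snoc1 : ∀ (x : Fin 2 → ℝ) (c : ℝ), (Fin.snoc x c : Fin 3 → ℝ) 1 = x 1 := fun _ _ => rfl
  have snoc2 : ∀ (x : Fin 2 → ℝ) (c : ℝ), (Fin.snoc x c : Fin 3 → ℝ) 2 = c := fun _ _ => rfl
  have hμ0 : 0 < μ := hμ.1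
  have hμ1 : μ < 1 := hμ.2
  have hbox : IsSemialgebraic ℚ {z : Fin 2 → ℝ | z 0 ∈ Ioo (0:ℝ) 1 ∧ z 1 ∈ Ioo (0:ℝ) 1} := by
    rw [← soloInformed_box_two_eq]; exact isSemialgebraic_box 2
  have hboxm : MeasurableSet {z : Fin 2 → ℝ | z 0 ∈ Ioo (0:ℝ) 1 ∧ z 1 ∈ Ioo (0:ℝ) 1} :=
    IsSemialgebraic.measurableSet_holds hbox
  have hH := soloInformed_legendre_isSemialgebraic_hband hμa
  have h0sa : IsSemialgebraicFunOn ℚ {z : Fin 2 → ℝ | z 0 ∈ Ioo (0:ℝ) 1 ∧ z 1 ∈ Ioo (0:ℝ) 1}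
      (fun _ => (0:ℝ)) := isSemialgebraicFunOn_const_of_isAlgebraic hbox isAlgebraic_zero
  have hμsa : IsSemialgebraicFunOn ℚ {z : Fin 2 → ℝ | z 0 ∈ Ioo (0:ℝ) 1 ∧ z 1 ∈ Ioo (0:ℝ) 1}
      (fun _ => μ) := isSemialgebraicFunOn_const_of_isAlgebraic hbox hμa
  have hwH : ∀ w ∈ KZlog.band {z : Fin 2 → ℝ | z 0 ∈ Ioo (0:ℝ) 1 ∧ z 1 ∈ Ioo (0:ℝ) 1}
      (fun _ => 0) (fun _ => μ),
      (0 ≤ w 0 ∧ w 0 ≤ 1) ∧ (0 ≤ w 1 ∧ w 1 ≤ 1) ∧ 0 ≤ w 2 ∧ w 2 < 1 := by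
    intro w hw
    rw [soloInformed_legendre_mem_hband] at hw
    exact ⟨⟨hw.1.1.1.le, hw.1.1.2.le⟩, ⟨hw.1.2.1.le, hw.1.2.2.le⟩, hw.2.1, hw.2.2.trans_lt hμ1⟩
  -- the potential `F` and its modulus derivative `∂_m F` are semialgebraic on the band
  have hF : IsSemialgebraicFunOn ℚ (KZlog.band {z : Fin 2 → ℝ | z 0 ∈ Ioo (0:ℝ) 1 ∧
      z 1 ∈ Ioo (0:ℝ) 1} (fun _ => 0) (fun _ => μ))
      (fun w => (1 - w 2 * w 0 ^ 2 - (1 - w 2) * w 1 ^ 2) *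
        ((√(1 - w 0 ^ 2))⁻¹ * (√(1 - w 2 * w 0 ^ 2))⁻¹ *
          ((√(1 - w 1 ^ 2))⁻¹ * (√(1 - (1 - w 2) * w 1 ^ 2))⁻¹))) := by
    refine soloInformed_legendre_sa_mul_kernel 0 1 2 hH hwH ?_
    refine (isSemialgebraicFunOn_aeval hH (1 - MvPolynomial.X 2 * MvPolynomial.X 0 ^ 2 -
      (1 - MvPolynomial.X 2) * MvPolynomial.X 1 ^ 2)).congr fun w _ => ?_
    simp only [map_sub, map_mul, map_pow, map_one, MvPolynomial.aeval_X]
  have hFv : IsSemialgebraicFunOn ℚ (KZlog.band {z : Fin 2 → ℝ | z 0 ∈ Ioo (0:ℝ) 1 ∧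
      z 1 ∈ Ioo (0:ℝ) 1} (fun _ => 0) (fun _ => μ))
      (fun w : Fin 3 → ℝ => ((w 1 ^ 2 - w 0 ^ 2) +
        (1 - w 2 * w 0 ^ 2 - (1 - w 2) * w 1 ^ 2) *
          (w 0 ^ 2 / (2 * (1 - w 2 * w 0 ^ 2)) - w 1 ^ 2 / (2 * (1 - (1 - w 2) * w 1 ^ 2)))) *
        ((√(1 - w 0 ^ 2))⁻¹ * (√(1 - w 2 * w 0 ^ 2))⁻¹ *
          ((√(1 - w 1 ^ 2))⁻¹ * (√(1 - (1 - w 2) * w 1 ^ 2))⁻¹))) := by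
    refine soloInformed_legendre_sa_mul_kernel 0 1 2 hH hwH ?_
    have hq1 : ∀ w ∈ KZlog.band {z : Fin 2 → ℝ | z 0 ∈ Ioo (0:ℝ) 1 ∧ z 1 ∈ Ioo (0:ℝ) 1}
        (fun _ => 0) (fun _ => μ),
        MvPolynomial.aeval w (2 * (1 - MvPolynomial.X 2 * MvPolynomial.X 0 ^ 2) :
          MvPolynomial (Fin 3) ℚ) ≠ 0 := by
      intro w hw
      rw [soloInformed_legendre_mem_hband] at hw
      simp only [map_sub, map_one, map_mul, map_pow, map_ofNat, MvPolynomial.aeval_X]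
      have : w 2 * w 0 ^ 2 ≤ μ * 1 :=
        mul_le_mul hw.2.2 (by nlinarith [hw.1.1.1, hw.1.1.2]) (sq_nonneg _) hμ0.le
      nlinarith
    have hq2 : ∀ w ∈ KZlog.band {z : Fin 2 → ℝ | z 0 ∈ Ioo (0:ℝ) 1 ∧ z 1 ∈ Ioo (0:ℝ) 1}
        (fun _ => 0) (fun _ => μ),
        MvPolynomial.aeval w (2 * (1 - (1 - MvPolynomial.X 2) * MvPolynomial.X 1 ^ 2) :
          MvPolynomial (Fin 3) ℚ) ≠ 0 := by
      intro w hw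
      rw [soloInformed_legendre_mem_hband] at hw
      simp only [map_sub, map_one, map_mul, map_pow, map_ofNat, MvPolynomial.aeval_X]
      have : (1 - w 2) * w 1 ^ 2 ≤ 1 * w 1 ^ 2 :=
        mul_le_mul_of_nonneg_right (by linarith [hw.2.1]) (sq_nonneg _)
      nlinarith [hw.1.2.1, hw.1.2.2]
    refine (IsSemialgebraicFunOn.add_holds
      (isSemialgebraicFunOn_aeval hH (MvPolynomial.X 1 ^ 2 - MvPolynomial.X 0 ^ 2))
      (IsSemialgebraicFunOn.mul_holds
        (isSemialgebraicFunOn_aeval hH (1 - MvPolynomial.X 2 * MvPolynomial.X 0 ^ 2 -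
          (1 - MvPolynomial.X 2) * MvPolynomial.X 1 ^ 2))
        (IsSemialgebraicFunOn.sub_holds
          (isSemialgebraicFunOn_aeval_div_aeval hH (MvPolynomial.X 0 ^ 2)
            (2 * (1 - MvPolynomial.X 2 * MvPolynomial.X 0 ^ 2)) hq1)
          (isSemialgebraicFunOn_aeval_div_aeval hH (MvPolynomial.X 1 ^ 2)
            (2 * (1 - (1 - MvPolynomial.X 2) * MvPolynomial.X 1 ^ 2)) hq2)))).congr
      fun w _ => ?_
    simp only [Pi.add_apply, Pi.mul_apply, Pi.sub_apply, map_sub, map_mul, map_pow, map_one,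
      map_ofNat, MvPolynomial.aeval_X]
  -- continuity and derivative along the modulus
  have hcont : ∀ z ∈ {z : Fin 2 → ℝ | z 0 ∈ Ioo (0:ℝ) 1 ∧ z 1 ∈ Ioo (0:ℝ) 1},
      ContinuousOn (fun m : ℝ => (fun w : Fin 3 → ℝ => (1 - w 2 * w 0 ^ 2 - (1 - w 2) * w 1 ^ 2) *
        ((√(1 - w 0 ^ 2))⁻¹ * (√(1 - w 2 * w 0 ^ 2))⁻¹ *
          ((√(1 - w 1 ^ 2))⁻¹ * (√(1 - (1 - w 2) * w 1 ^ 2))⁻¹))) (Fin.snoc z m))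
        (Icc ((fun _ : Fin 2 → ℝ => (0:ℝ)) z) ((fun _ : Fin 2 → ℝ => μ) z)) := by
    intro z hz
    have h : z 0 ∈ Ioo (0:ℝ) 1 ∧ z 1 ∈ Ioo (0:ℝ) 1 := hz
    simp only [snoc0, snoc1, snoc2]
    intro m hm
    exact (soloInformed_legendre_hasDerivAt_m h.1 h.2 hm.1
      (hm.2.trans_lt hμ1)).continuousAt.continuousWithinAt
  have hder : ∀ z ∈ {z : Fin 2 → ℝ | z 0 ∈ Ioo (0:ℝ) 1 ∧ z 1 ∈ Ioo (0:ℝ) 1},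
      ∀ m ∈ Ioo ((fun _ : Fin 2 → ℝ => (0:ℝ)) z) ((fun _ : Fin 2 → ℝ => μ) z),
      HasDerivAt (fun m : ℝ => (fun w : Fin 3 → ℝ => (1 - w 2 * w 0 ^ 2 - (1 - w 2) * w 1 ^ 2) *
        ((√(1 - w 0 ^ 2))⁻¹ * (√(1 - w 2 * w 0 ^ 2))⁻¹ *
          ((√(1 - w 1 ^ 2))⁻¹ * (√(1 - (1 - w 2) * w 1 ^ 2))⁻¹))) (Fin.snoc z m))
        ((fun w : Fin 3 → ℝ => ((w 1 ^ 2 - w 0 ^ 2) +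
          (1 - w 2 * w 0 ^ 2 - (1 - w 2) * w 1 ^ 2) *
            (w 0 ^ 2 / (2 * (1 - w 2 * w 0 ^ 2)) - w 1 ^ 2 / (2 * (1 - (1 - w 2) * w 1 ^ 2)))) *
          ((√(1 - w 0 ^ 2))⁻¹ * (√(1 - w 2 * w 0 ^ 2))⁻¹ *
            ((√(1 - w 1 ^ 2))⁻¹ * (√(1 - (1 - w 2) * w 1 ^ 2))⁻¹))) (Fin.snoc z m)) m := by
    intro z hz m hm
    have h : z 0 ∈ Ioo (0:ℝ) 1 ∧ z 1 ∈ Ioo (0:ℝ) 1 := hz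
    simp only [snoc0, snoc1, snoc2]
    exact soloInformed_legendre_hasDerivAt_m h.1 h.2 hm.1.le (hm.2.trans hμ1)
  -- the two fibre ends: semialgebraic and integrable on the square
  have hφ : IsSemialgebraicMapOn ℚ {z : Fin 2 → ℝ | z 0 ∈ Ioo (0:ℝ) 1 ∧ z 1 ∈ Ioo (0:ℝ) 1}
      (fun z => (Fin.snoc z μ : Fin 3 → ℝ)) := by
    refine IsSemialgebraicMapOn.of_forall hbox fun j => ?_
    induction j using Fin.lastCases with
    | last => simp only [Fin.snoc_last]; exact hμsa
    | cast i => simp only [Fin.snoc_castSucc]; exact isSemialgebraicFunOn_apply hbox i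
  have hmaps : MapsTo (fun z => (Fin.snoc z μ : Fin 3 → ℝ))
      {z : Fin 2 → ℝ | z 0 ∈ Ioo (0:ℝ) 1 ∧ z 1 ∈ Ioo (0:ℝ) 1}
      (KZlog.band {z : Fin 2 → ℝ | z 0 ∈ Ioo (0:ℝ) 1 ∧ z 1 ∈ Ioo (0:ℝ) 1}
        (fun _ => 0) (fun _ => μ)) :=
    fun z hz => KZlog.snoc_mem_band.2 ⟨hz, hμ0.le, le_rfl⟩
  have hFμ : IsSemialgebraicFunOn ℚ {z : Fin 2 → ℝ | z 0 ∈ Ioo (0:ℝ) 1 ∧ z 1 ∈ Ioo (0:ℝ) 1}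
      (fun z : Fin 2 → ℝ => (1 - μ * z 0 ^ 2 - (1 - μ) * z 1 ^ 2) *
        ((√(1 - z 0 ^ 2))⁻¹ * (√(1 - μ * z 0 ^ 2))⁻¹ *
          ((√(1 - z 1 ^ 2))⁻¹ * (√(1 - (1 - μ) * z 1 ^ 2))⁻¹))) := by
    refine (hF.comp_isSemialgebraicMapOn_holds hφ hmaps).congr fun z _ => ?_
    simp only [Function.comp_apply, snoc0, snoc1, snoc2]
  have hsa0 : IsSemialgebraicFunOn ℚ {z : Fin 2 → ℝ | z 0 ∈ Ioo (0:ℝ) 1 ∧ z 1 ∈ Ioo (0:ℝ) 1}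
      (fun z : Fin 2 → ℝ => (√(1 - z 0 ^ 2))⁻¹) := by
    refine (soloInformed_sa_inv_sqrt_aeval hbox (1 - MvPolynomial.X 0 ^ 2) fun z hz => ?_).congr
      fun z _ => ?_
    · simp only [map_sub, map_one, map_pow, MvPolynomial.aeval_X]
      have h : z 0 ∈ Ioo (0:ℝ) 1 := hz.1
      nlinarith [h.1, h.2]
    · simp only [map_sub, map_one, map_pow, MvPolynomial.aeval_X]
  have hI0 := soloInformed_integrableOn_inv_sqrt_box2
  have hIμ : IntegrableOn (fun z : Fin 2 → ℝ => (1 - μ * z 0 ^ 2 - (1 - μ) * z 1 ^ 2) *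
        ((√(1 - z 0 ^ 2))⁻¹ * (√(1 - μ * z 0 ^ 2))⁻¹ *
          ((√(1 - z 1 ^ 2))⁻¹ * (√(1 - (1 - μ) * z 1 ^ 2))⁻¹)))
      {z : Fin 2 → ℝ | z 0 ∈ Ioo (0:ℝ) 1 ∧ z 1 ∈ Ioo (0:ℝ) 1} := by
    refine soloInformed_integrableOn_of_le_inv_sqrt_prod hbox hFμ ∅ {0} ∅ {0, 1}
      (2 * (√(1 - μ))⁻¹ * (1 + (√μ)⁻¹)) ∅ measure_empty
      (fun z hz _ j => ?_) (fun z _ hc => ?_)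
    · have h : z 0 ∈ Ioo (0:ℝ) 1 ∧ z 1 ∈ Ioo (0:ℝ) 1 := hz
      fin_cases j
      · exact h.1
      · exact h.2
    · have hs := hc 0
      have ht := hc 1
      have hK := soloInformed_legendre_kernel_le (s := z 0) (t := z 1) (m := μ) (μ := μ)
        hs ht hμ0 le_rfl hμ1
      have hK0 : 0 ≤ (√(1 - z 0 ^ 2))⁻¹ * (√(1 - μ * z 0 ^ 2))⁻¹ *
          ((√(1 - z 1 ^ 2))⁻¹ * (√(1 - (1 - μ) * z 1 ^ 2))⁻¹) := by positivity
      have hN : |1 - μ * z 0 ^ 2 - (1 - μ) * z 1 ^ 2| ≤ 1 := by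
        rw [abs_le]
        constructor
        · nlinarith [hs.1, hs.2, ht.1, ht.2, mul_pos hμ0 (mul_pos hs.1 hs.1)]
        · nlinarith [hs.1, hs.2, ht.1, ht.2, mul_pos hμ0 (mul_pos hs.1 hs.1)]
      have ha : 0 ≤ (√(1 - μ))⁻¹ := by positivity
      have hb : 0 ≤ (√μ)⁻¹ := by positivity
      have hX : 0 ≤ (√(1 - z 0))⁻¹ := by positivity
      have hY : 0 ≤ (√(1 - z 1))⁻¹ := by positivity
      rw [abs_mul, abs_of_nonneg hK0, Finset.prod_empty, Finset.prod_singleton,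
        Finset.prod_pair (by decide)]
      calc |1 - μ * z 0 ^ 2 - (1 - μ) * z 1 ^ 2| *
            ((√(1 - z 0 ^ 2))⁻¹ * (√(1 - μ * z 0 ^ 2))⁻¹ *
              ((√(1 - z 1 ^ 2))⁻¹ * (√(1 - (1 - μ) * z 1 ^ 2))⁻¹))
          ≤ 1 * ((√(1 - μ))⁻¹ * (2 * (√(1 - z 0))⁻¹ +
              2 * ((√(1 - z 0))⁻¹ * (√(1 - z 1))⁻¹ * (√μ)⁻¹))) :=
            mul_le_mul hN hK hK0 zero_le_one
        _ ≤ 2 * (√(1 - μ))⁻¹ * (1 + (√μ)⁻¹) *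
              (1 * (√(1 - z 0))⁻¹ + 1 * ((√(1 - z 0))⁻¹ * (√(1 - z 1))⁻¹)) := by
            nlinarith [mul_nonneg (mul_nonneg ha hb) hX, mul_nonneg (mul_nonneg ha hX) hY]
  -- boundary data of the Newton–Leibniz move
  have hds : IsSemialgebraicFunOn ℚ {z : Fin 2 → ℝ | z 0 ∈ Ioo (0:ℝ) 1 ∧ z 1 ∈ Ioo (0:ℝ) 1}
      (fun z => (fun w : Fin 3 → ℝ => (1 - w 2 * w 0 ^ 2 - (1 - w 2) * w 1 ^ 2) *
        ((√(1 - w 0 ^ 2))⁻¹ * (√(1 - w 2 * w 0 ^ 2))⁻¹ *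
          ((√(1 - w 1 ^ 2))⁻¹ * (√(1 - (1 - w 2) * w 1 ^ 2))⁻¹)))
          (Fin.snoc z ((fun _ : Fin 2 → ℝ => μ) z)) -
        (fun w : Fin 3 → ℝ => (1 - w 2 * w 0 ^ 2 - (1 - w 2) * w 1 ^ 2) *
        ((√(1 - w 0 ^ 2))⁻¹ * (√(1 - w 2 * w 0 ^ 2))⁻¹ *
          ((√(1 - w 1 ^ 2))⁻¹ * (√(1 - (1 - w 2) * w 1 ^ 2))⁻¹)))
          (Fin.snoc z ((fun _ : Fin 2 → ℝ => (0:ℝ)) z))) := by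
    refine (hFμ.sub_holds hsa0).congr fun z hz => ?_
    have h : z 0 ∈ Ioo (0:ℝ) 1 ∧ z 1 ∈ Ioo (0:ℝ) 1 := hz
    simp only [Pi.sub_apply, snoc0, snoc1, snoc2]
    rw [soloInformed_legendre_fibre_zero (z 0) h.2]
  have hdi : IntegrableOn
      (fun z => (fun w : Fin 3 → ℝ => (1 - w 2 * w 0 ^ 2 - (1 - w 2) * w 1 ^ 2) *
        ((√(1 - w 0 ^ 2))⁻¹ * (√(1 - w 2 * w 0 ^ 2))⁻¹ *
          ((√(1 - w 1 ^ 2))⁻¹ * (√(1 - (1 - w 2) * w 1 ^ 2))⁻¹)))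
          (Fin.snoc z ((fun _ : Fin 2 → ℝ => μ) z)) -
        (fun w : Fin 3 → ℝ => (1 - w 2 * w 0 ^ 2 - (1 - w 2) * w 1 ^ 2) *
        ((√(1 - w 0 ^ 2))⁻¹ * (√(1 - w 2 * w 0 ^ 2))⁻¹ *
          ((√(1 - w 1 ^ 2))⁻¹ * (√(1 - (1 - w 2) * w 1 ^ 2))⁻¹)))
          (Fin.snoc z ((fun _ : Fin 2 → ℝ => (0:ℝ)) z)))
      {z : Fin 2 → ℝ | z 0 ∈ Ioo (0:ℝ) 1 ∧ z 1 ∈ Ioo (0:ℝ) 1} := by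
    refine (hIμ.sub hI0).congr_fun (fun z hz => ?_) hboxm
    have h : z 0 ∈ Ioo (0:ℝ) 1 ∧ z 1 ∈ Ioo (0:ℝ) 1 := hz
    simp only [Pi.sub_apply, snoc0, snoc1, snoc2]
    rw [soloInformed_legendre_fibre_zero (z 0) h.2]
  -- Newton–Leibniz in the modulus
  obtain ⟨rb, rd, hrbd, hrbi, hrdd, hrdi, hrel⟩ := exists_band_newtonLeibniz hbox
    (fun _ => (0:ℝ)) (fun _ => μ) h0sa hμsa (fun _ _ => hμ0.le) _ _ hF hFv hcont hder
    (soloInformed_legendre_integrableOn_Fv μ hμ hμa) hds hdi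
  have hrb : of rb ∈ relations :=
    soloInformed_legendre_exact μ hμ hμa rb hrbd (by rw [hrbi]; exact fun _ _ => rfl)
  have hrd : of rd ∈ relations := by
    have := relations.sub_mem hrb hrel
    simpa using this
  -- the two ends as representations on the square
  set Rμ : IntegralRep 2 := ⟨{z : Fin 2 → ℝ | z 0 ∈ Ioo (0:ℝ) 1 ∧ z 1 ∈ Ioo (0:ℝ) 1},
    fun z : Fin 2 → ℝ => (1 - μ * z 0 ^ 2 - (1 - μ) * z 1 ^ 2) *
      ((√(1 - z 0 ^ 2))⁻¹ * (√(1 - μ * z 0 ^ 2))⁻¹ *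
        ((√(1 - z 1 ^ 2))⁻¹ * (√(1 - (1 - μ) * z 1 ^ 2))⁻¹)), hbox, hFμ, hIμ⟩ with hRμ
  set R₀ : IntegralRep 2 := ⟨{z : Fin 2 → ℝ | z 0 ∈ Ioo (0:ℝ) 1 ∧ z 1 ∈ Ioo (0:ℝ) 1},
    fun z : Fin 2 → ℝ => (√(1 - z 0 ^ 2))⁻¹, hbox, hsa0, hI0⟩ with hR₀
  have hadd : of Rμ - of rd - of R₀ ∈ relations := by
    refine integrandAddRel_subset_relations ⟨2, Rμ, rd, R₀, hrdd, rfl, fun z hz => ?_, rfl⟩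
    have h : z 0 ∈ Ioo (0:ℝ) 1 ∧ z 1 ∈ Ioo (0:ℝ) 1 := hz
    rw [Pi.add_apply, hrdi]
    simp only [hRμ, hR₀, snoc0, snoc1, snoc2]
    rw [soloInformed_legendre_fibre_zero (z 0) h.2]
    ring
  refine ⟨Rμ, R₀, rfl, fun z => rfl, rfl, fun z => rfl, ?_⟩
  have h := relations.add_mem hadd hrd
  have e : of Rμ - of R₀ = of Rμ - of rd - of R₀ + of rd := by abel
  rw [e]
  exact h

end Summit.KontsevichZagierPeriods.KontsevichZagierPeriods.Theorems

end
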